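import Literature.MathematicalPhysics.QuantumFieldTheory.Balaban1983to89.Node00.OpsYSectDCoords
import Literature.MathematicalPhysics.QuantumFieldTheory.Balaban1983to89.B9Thm312Whole

/-!
# BalabanUVNodes ∕ N06 ([B9], `Dag.B9_main`) — TWO OF SECT. D's DISPLAYED UNITS, Δ_{π,a}(U) = Δ_a − Δ′_π AND Δ⁽¹⁾(U) = Δ_a − Δ′_π − Δ⁽²⁾_π,
# FROM THE FORM SMALLNESS (3.120) AND THE POSITIVITY OF Δ_a AT node00-def-Y's PINS

Track A of `YM-PLAN.md` (cell `pub-ymgap`, HUMAN RULING D-0062), node **N06** = [Balaban1985BackgroundPropagators] Thms 3.1–3.15;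
seat `pub-ymgap-dag-n06-d` (s2, «knit N06 at the ₁₁ record»).  A HELPER for the stage-11 certificate editions ≥ 15.

WHAT.  Edition 14 of the certificate (`…N06AtOpsYNuOfRecordV6EPairMU`) discharges the ten definitional Sect.-D identities at
node00-def-Y g10's coordinate models (`Node00.OpsYSectDCoords`, n06-l g11 `identitiesDef_of_pins`) under def-Y's displayed side conditions,
among them the units `IsUnit (deltaPiAY …)` (G = (Δ_a − Δ′_π)⁻¹ exists, (3.122)) and `IsUnit (deltaOneY …)` (G₁ = (Δ_a − Δ′_π − Δ⁽²⁾_π)⁻¹ exists,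
(3.128)).  Print (p. 420): *"we will prove that this term is a small perturbation of Δ_a"*; (3.120)∕(3.131)∕(3.137) give |⟨f, Δ′_πf⟩| ≦ r⟨f, Δ_af⟩ with
r = O(1)·Mα₀ < 1, hence Δ_a − Δ′_π ≧ (1 − r)Δ_a > 0 is invertible on the finite lattice — and that form smallness is EXACTLY rows 20–21's
displayed schema `FormSmall (𝔬12 x) (r12·Mα₀) U` (its `posS0` member is Theorem 3.11 for Δ_a, its `small ∕ small1` members the two
relative bounds) about the MODEL operators `(𝔬12 x).S0 ∕ .Tpi ∕ .T2`, which edition 14 PINS to def-Y's `S0coK ∕ TpicoK ∕ T2coK` =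
c⁻¹·(the coordinate models of Δ_a ∕ Δ′_π ∕ Δ⁽²⁾_π over the trace basis).  THIS FILE closes the loop:
* `injective_sub_of_form_bound` — S > 0 as a form, |⟨f, Tf⟩| ≦ r⟨f, Sf⟩, r < 1 ⟹ S − T injective (finite real coordinates);
* `injective_of_coordOpK_const` — the coordinate model of a CONSTANT direction family is injective only if the operator is (encode a kernel
  vector by its basis coordinates; `assembleK` re-assembles it, `b.sum_repr`);
* ★ `isUnit_deltaPiAY_of_formSmall`, ★ `isUnit_deltaOneY_of_formSmall` — at one member and one U: `FormSmall 𝔬 r U`, `r < 1`, the pins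
  `hS0 hTpi (hT2)` and `0 < N` give the two units (def-Y `deltaPiAY_eq_deltaAY_sub ∕ deltaOneY_eq_deltaAY_sub`, `coordOpK_sub`, n06-j
  `isUnit_of_injective`);
* §3 `dotProduct_coordOpK_const_eq_sum_trIP` (the real coordinate form of the model of a constant family = the sum over the slices of the trace
  forms: the trace basis is orthonormal, n06-d `trBasis_repr_eq_trace ∕ assembleK_pairing ∕ sum_trReForm_eq_trIP`) and ★ `posDefEnd_S0coK_of_posDefTr` —
  the `posS0` member of `FormSmall` (Δ_a > 0 in real coordinates) at the pin `S0coK` FROM row 17's displayed Theorem-3.11 positivity `PosDefTr 1 (deltaAY …)`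
  (for the edition that consumes n06-l g12's `FormSmall`-from-`StepL2` face, which keeps `posS0` as its input);
* §4 (v1.1) `posDefTr_of_posDefEnd_coordOpK_const` (one-slice encoding: a positive real-coordinate model of a constant family gives a positive trace
  form) and ★ `posDefTr_deltaOneY_of_formSmall_pins` — Δ⁽¹⁾ = Δ_a − Δ′_π − Δ⁽²⁾_π > 0 IN TRACE CURRENCY from the form smallness at the pins: the one input
  `hΔ1` of node00-def-Y g12's `isUnit_QGQOfY_G1Y_record_of_posDefTr` (`Node00/OpsYQOnto`, Q onto ∕ Q* injective at every U), which discharges the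
  certificate's last displayed unit `hUQ` (QG₁Q*).

HONEST FRAMING.  Finite-dimensional linear algebra (a positive form has trivial kernel; finite dimension); COUNT-NEUTRAL; nothing of [B9]
asserted — the form smallness itself remains the displayed schema (n06-l g12 is deriving it from `StepL2` + Theorem 3.3's L² members);
N06 NOT discharged.  One finite 𝕋⁴ programme at fixed `ε` — NOT continuum, NOT OS, NOT the mass gap ∕ Clay.  0 `def`, 0 `sorry`.
-/

noncomputable section

namespace Summit.QuantumFields.YangMills.BalabanUVNodes.N06SectDUnitsAtPins

open Literature.MathematicalPhysics.QuantumFieldTheory.Balaban1983to89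
open Literature.MathematicalPhysics.QuantumFieldTheory.Balaban1983to89.Node00
open Literature.MathematicalPhysics.QuantumFieldTheory.Balaban1983to89.Node00.OpsYSectDCoords (S0coK TpicoK T2coK cR39_trBasis_pos coordOpK_sub coordOpK_add repr_assembleK)
open Literature.MathematicalPhysics.QuantumFieldTheory.Balaban1983to89.B9CoReadingCoords (XBK assembleK coordOpK coordOpK_apply)
open Literature.MathematicalPhysics.QuantumFieldTheory.Balaban1983to89.B9CoReadingCoordsTranspose
  (TrIdx trBasis trReForm trReForm_apply assembleK_pairing sum_trReForm_eq_trIP trBasis_repr_eq_trace)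
open Literature.MathematicalPhysics.QuantumFieldTheory.Balaban1983to89.B9Thm39ReadingCoords (cR39)
open Literature.MathematicalPhysics.QuantumFieldTheory.Balaban1983to89.B9Thm312Whole (Ops FormSmall PosDefEnd)
open Literature.MathematicalPhysics.QuantumFieldTheory.Balaban1983to89.B9Thm311ReadingCoords (isUnit_of_injective trIP PosDefTr)
open Literature.MathematicalPhysics.QuantumFieldTheory.Balaban1983to89.B9Eq3132SectDLetters (deltaPiAY)
open Literature.MathematicalPhysics.QuantumFieldTheory.Balaban1983to89.B6KLevelCensusIndexV1 (KIdx)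
open scoped Matrix
open scoped Matrix.Norms.L2Operator

/-! ## §1 Two generic facts: a dominated perturbation of a positive form has trivial kernel; the coordinate model reflects injectivity -/

section Generic

/-- **S − T is injective when S > 0 as a form and |⟨f, Tf⟩| ≦ r⟨f, Sf⟩ with r < 1** (then ⟨f, (S − T)f⟩ ≧ (1 − r)⟨f, Sf⟩ > 0 for f ≠ 0) —
print's «small perturbation of Δ_a» (p. 420) made quantitative on the finite real coordinate space. [cite: Balaban1985BackgroundPropagators, (3.120) p.419–420 + Thm 3.11 p.416] -/
theorem injective_sub_of_form_bound {X : Type} [Fintype X] (S T : Module.End ℝ (X → ℝ)) {r : ℝ} (hS : PosDefEnd S)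
    (hT : ∀ f : X → ℝ, |f ⬝ᵥ T f| ≤ r * (f ⬝ᵥ S f)) (hr : r < 1) : Function.Injective (S - T) := by
  refine (injective_iff_map_eq_zero _).mpr fun f hf => by_contra fun hne => ?_
  have hpos : 0 < f ⬝ᵥ S f := hS f hne
  have h1 : f ⬝ᵥ (S - T) f = 0 := by rw [hf]; exact dotProduct_zero f
  have h2 : f ⬝ᵥ (S - T) f = f ⬝ᵥ S f - f ⬝ᵥ T f := by rw [LinearMap.sub_apply, dotProduct_sub]
  have h3 : f ⬝ᵥ T f ≤ r * (f ⬝ᵥ S f) := (abs_le.mp (hT f)).2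
  have h4 : r * (f ⬝ᵥ S f) < f ⬝ᵥ S f := mul_lt_of_lt_one_left hpos hr
  linarith

/-- **THE COORDINATE MODEL OF A CONSTANT DIRECTION FAMILY REFLECTS INJECTIVITY**: if `coordOpK b (fun _ => T)` (n06-d `B9CoReadingCoords`: slice-wise
conjugation of T by the coordinates of the real basis `b` of `𝔸`) is injective, so is T — a kernel vector A of T, encoded by its coordinates
`(z, ν, a, c′) ↦ repr_a(A z)` constantly in (ν, c′), re-assembles to A in every slice (`b.sum_repr`), so its image is 0.
[cite: Balaban1985BackgroundPropagators, (3.42) p.397 (the operators read in coordinates), dictionary] -/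
theorem injective_of_coordOpK_const {S D κ 𝔸 : Type} [Fintype κ] [DecidableEq κ] [NormedRing 𝔸] [NormedAlgebra ℂ 𝔸] [Nonempty D]
    [Nonempty κ] (b : Module.Basis κ ℝ 𝔸) (T : (S → 𝔸) →ₗ[ℝ] (S → 𝔸))
    (h : Function.Injective (coordOpK b (fun _ : D => T))) : Function.Injective T := by
  refine (injective_iff_map_eq_zero _).mpr fun A hA => ?_
  obtain ⟨ν₀⟩ := ‹Nonempty D›
  obtain ⟨c₀⟩ := ‹Nonempty κ›
  set f : S × D × κ × κ → ℝ := fun p => b.repr (A p.1) p.2.2.1 with hf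
  have hAf : ∀ (ν : D) (c' : κ), assembleK b ν c' f = A := fun ν c' => by
    funext z
    simp only [assembleK, hf]
    exact b.sum_repr (A z)
  have h0 : coordOpK b (fun _ : D => T) f = 0 := by
    funext p
    rw [coordOpK_apply, hAf, hA]
    simp
  have hf0 : f = 0 := h (by rw [h0, map_zero])
  funext z
  have hz : ∀ a : κ, b.repr (A z) a = 0 := fun a => by
    have h' := congrFun hf0 (z, ν₀, a, c₀)
    simpa only [hf, Pi.zero_apply] using h'
  have hr : b.repr (A z) = 0 := Finsupp.ext hz
  simpa using hr

/-- an injective scalar multiple has an injective underlying map. [folklore] -/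
theorem injective_of_smul_injective {M : Type} [AddCommGroup M] [Module ℝ M] {c : ℝ} {L : Module.End ℝ M}
    (h : Function.Injective (c • L)) : Function.Injective L := fun u v huv =>
  h (by simp only [LinearMap.smul_apply, huv])

end Generic

/-! ## §2 The two units at node00-def-Y's pins -/

section Pins

variable {N : ℕ} {d ℓ : ℕ} {hd : 1 ≤ d + 1} {hL : Odd (ℓ + 1) ∧ 1 < ℓ + 1} {b₀ b₁ : ℝ}

/-- `TrIdx N` is inhabited for `0 < N`. [folklore] -/
private theorem nonempty_trIdx (hN : 0 < N) : Nonempty (TrIdx N) := ⟨(⟨0, hN⟩, ⟨0, hN⟩, 0)⟩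

/-- ★ **THE UNIT Δ_{π,a}(U) = Δ_a − Δ′_π ((3.122): G = (Δ_a − Δ′_π)⁻¹ exists) FROM THE FORM SMALLNESS AT THE PINS**: at one member and one U, rows
20–21's displayed `FormSmall 𝔬 r U` (Δ_a > 0 and |⟨f, Δ′_πf⟩| ≦ r⟨f, Δ_af⟩ on the model operators) with r < 1 and edition 14's pins of `𝔬.S0 ∕ 𝔬.Tpi` to
node00-def-Y's `S0coK ∕ TpicoK` (c⁻¹·coordinate models of Δ_a ∕ Δ′_π over the trace basis) give `IsUnit (deltaPiAY …)` — def-Y's displayed side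
condition `hUπ` of the identity (Δ_a − Δ′_π)G = I.  Chain: S0 − Tpi injective (`injective_sub_of_form_bound`) = c⁻¹·coordOpK of Δ_a − Δ′_π
(`coordOpK_sub`, `deltaPiAY_eq_deltaAY_sub`) ⟹ Δ_a − Δ′_π injective (`injective_of_coordOpK_const`) ⟹ unit (n06-j `isUnit_of_injective`, finite lattice).
[cite: Balaban1985BackgroundPropagators, (3.120)–(3.122) pp.419–420 + Thm 3.11 p.416] -/
theorem isUnit_deltaPiAY_of_formSmall (i : KIdx d ℓ hd hL b₀ b₁) (B : B9.Backgrounds) (cfg : B.Cfg → CfgY (Matrix (Fin N) (Fin N) ℂ) i)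
    {g : B9.Geometry} {Y Z W : Type} [Fintype Y] [Fintype Z] [Fintype W]
    (𝔬 : Ops g B (XBK (TrIdx N) i) Y Z W) (U : B.Cfg) {r : ℝ} (hN : 0 < N) (hF : FormSmall 𝔬 r U) (hr : r < 1)
    (hS0 : 𝔬.S0 U = S0coK i (trBasis N) B cfg (parSymY i) (parBY i) (GpY i (parSymY i)) U)
    (hTpi : 𝔬.Tpi U = TpicoK i (trBasis N) B cfg (parSymY i) (GpY i (parSymY i)) U) :
    IsUnit (deltaPiAY i (parSymY i) (parBY i) (GpY i (parSymY i)) (cfg U)) := by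
  haveI : Nonempty (TrIdx N) := nonempty_trIdx hN
  have hinj : Function.Injective (𝔬.S0 U - 𝔬.Tpi U) := injective_sub_of_form_bound _ _ hF.posS0 hF.small hr
  have hEq : 𝔬.S0 U - 𝔬.Tpi U = (cR39 (trBasis N))⁻¹ •
      coordOpK (trBasis N) (fun _ : Fin (d + 1) => (deltaPiAY i (parSymY i) (parBY i) (GpY i (parSymY i)) (cfg U)).restrictScalars ℝ) := by
    have hfam : (fun _ : Fin (d + 1) => (deltaPiAY i (parSymY i) (parBY i) (GpY i (parSymY i)) (cfg U)).restrictScalars ℝ) =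
        fun _ : Fin (d + 1) => (deltaAY i (parSymY i) (parBY i) (GpY i (parSymY i)) (cfg U)).restrictScalars ℝ -
          (deltaPiPrimeY i (parSymY i) (GpY i (parSymY i)) (cfg U)).restrictScalars ℝ := by
      funext ν
      apply LinearMap.ext
      intro v
      simp only [LinearMap.coe_restrictScalars, LinearMap.sub_apply, deltaPiAY_eq_deltaAY_sub]
    rw [hS0, hTpi, hfam, coordOpK_sub, smul_sub]
    rfl
  rw [hEq] at hinj
  have hinj2 := injective_of_coordOpK_const (trBasis N) _ (injective_of_smul_injective hinj)
  exact isUnit_of_injective (fun u v huv => hinj2 (by simpa only [LinearMap.coe_restrictScalars] using huv))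

/-- ★ **THE UNIT Δ⁽¹⁾(U) = Δ_a − Δ′_π − Δ⁽²⁾_π ((3.128): G₁ exists) FROM THE FORM SMALLNESS AT THE PINS**: as `isUnit_deltaPiAY_of_formSmall`, with the
second relative bound `FormSmall.small1` (|⟨f, (Δ′_π + Δ⁽²⁾_π)f⟩| ≦ r⟨f, Δ_af⟩) and the pin of `𝔬.T2` to def-Y's `T2coK` — def-Y's displayed side condition
`hU1` of the identity (Δ_a − Δ′_π − Δ⁽²⁾_π)G₁ = I. [cite: Balaban1985BackgroundPropagators, (3.128) p.421 + (3.134)–(3.137) pp.422–423 + Thm 3.11 p.416] -/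
theorem isUnit_deltaOneY_of_formSmall (i : KIdx d ℓ hd hL b₀ b₁) (B : B9.Backgrounds) (cfg : B.Cfg → CfgY (Matrix (Fin N) (Fin N) ℂ) i)
    (Δ2 : BondOpY (Matrix (Fin N) (Fin N) ℂ) i) {g : B9.Geometry} {Y Z W : Type} [Fintype Y] [Fintype Z] [Fintype W]
    (𝔬 : Ops g B (XBK (TrIdx N) i) Y Z W) (U : B.Cfg) {r : ℝ} (hN : 0 < N) (hF : FormSmall 𝔬 r U) (hr : r < 1)
    (hS0 : 𝔬.S0 U = S0coK i (trBasis N) B cfg (parSymY i) (parBY i) (GpY i (parSymY i)) U)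
    (hTpi : 𝔬.Tpi U = TpicoK i (trBasis N) B cfg (parSymY i) (GpY i (parSymY i)) U)
    (hT2 : 𝔬.T2 U = T2coK i (trBasis N) B cfg (parSymY i) (GpY i (parSymY i)) Δ2 U) :
    IsUnit (deltaOneY i (parSymY i) (parBY i) (GpY i (parSymY i)) Δ2 (cfg U)) := by
  haveI : Nonempty (TrIdx N) := nonempty_trIdx hN
  have hinj : Function.Injective (𝔬.S0 U - (𝔬.Tpi U + 𝔬.T2 U)) := injective_sub_of_form_bound _ _ hF.posS0 hF.small1 hr
  have hEq : 𝔬.S0 U - (𝔬.Tpi U + 𝔬.T2 U) = (cR39 (trBasis N))⁻¹ •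
      coordOpK (trBasis N) (fun _ : Fin (d + 1) => (deltaOneY i (parSymY i) (parBY i) (GpY i (parSymY i)) Δ2 (cfg U)).restrictScalars ℝ) := by
    have hfam : (fun _ : Fin (d + 1) => (deltaOneY i (parSymY i) (parBY i) (GpY i (parSymY i)) Δ2 (cfg U)).restrictScalars ℝ) =
        fun _ : Fin (d + 1) => (deltaAY i (parSymY i) (parBY i) (GpY i (parSymY i)) (cfg U)).restrictScalars ℝ -
          ((deltaPiPrimeY i (parSymY i) (GpY i (parSymY i)) (cfg U)).restrictScalars ℝ +
            (delta2PiY i (parSymY i) (GpY i (parSymY i)) Δ2 (cfg U)).restrictScalars ℝ) := by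
      funext ν
      apply LinearMap.ext
      intro v
      simp only [LinearMap.coe_restrictScalars, LinearMap.sub_apply, LinearMap.add_apply, deltaOneY_eq_deltaAY_sub]
    rw [hS0, hTpi, hT2, hfam, coordOpK_sub, coordOpK_add, smul_sub, smul_add]
    rfl
  rw [hEq] at hinj
  have hinj2 := injective_of_coordOpK_const (trBasis N) _ (injective_of_smul_injective hinj)
  exact isUnit_of_injective (fun u v huv => hinj2 (by simpa only [LinearMap.coe_restrictScalars] using huv))

end Pins

/-! ## §3 The `posS0` member of `FormSmall` at the pins from row 17's positivity of Δ_a -/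

section PosS0

variable {N : ℕ}

/-- **THE REAL COORDINATE FORM OF THE MODEL OF A CONSTANT FAMILY IS THE SUM OF THE TRACE FORMS OVER THE SLICES**:
`f ⬝ᵥ coordOpK (trBasis N) (fun _ => T) f = Σ_{ν,c′} trIP 1 (A_{ν,c′}) (T A_{ν,c′})` with `A_{ν,c′} = assembleK (trBasis N) ν c′ f` — the trace basis is
orthonormal for `Re tr(vᴴw)` (`trBasis_repr_eq_trace`), so the coordinates of `T A` pair with those of `A` to the trace pairing (`assembleK_pairing`,
`sum_trReForm_eq_trIP`). [cite: Balaban1985BackgroundPropagators, p.393 (scalar products) + (3.42) p.397 (coordinates), dictionary] -/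
theorem dotProduct_coordOpK_const_eq_sum_trIP {S D : Type} [Fintype S] [Fintype D]
    (T : (S → Matrix (Fin N) (Fin N) ℂ) →ₗ[ℝ] (S → Matrix (Fin N) (Fin N) ℂ)) (f : S × D × TrIdx N × TrIdx N → ℝ) :
    f ⬝ᵥ coordOpK (trBasis N) (fun _ : D => T) f =
      ∑ ν : D, ∑ c' : TrIdx N, trIP (fun _ => (1 : ℝ)) (assembleK (trBasis N) ν c' f) (T (assembleK (trBasis N) ν c' f)) := by
  classical
  have hpt : ∀ p : S × D × TrIdx N × TrIdx N, f p * coordOpK (trBasis N) (fun _ : D => T) f p =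
      f (p.1, p.2.1, p.2.2.1, p.2.2.2) * trReForm (trBasis N p.2.2.1) (T (assembleK (trBasis N) p.2.1 p.2.2.2 f) p.1) := fun p => by
    rw [coordOpK_apply, trBasis_repr_eq_trace, trReForm_apply]
  calc f ⬝ᵥ coordOpK (trBasis N) (fun _ : D => T) f
      = ∑ p : S × D × TrIdx N × TrIdx N, f p * coordOpK (trBasis N) (fun _ : D => T) f p := rfl
    _ = ∑ x : S, ∑ ν : D, ∑ c : TrIdx N, ∑ c' : TrIdx N,
          f (x, ν, c, c') * trReForm (trBasis N c) (T (assembleK (trBasis N) ν c' f) x) := by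
        simp only [hpt, Fintype.sum_prod_type]
    _ = ∑ ν : D, ∑ c' : TrIdx N, ∑ x : S, ∑ c : TrIdx N,
          f (x, ν, c, c') * trReForm (trBasis N c) (T (assembleK (trBasis N) ν c' f) x) := by
        rw [Finset.sum_comm]
        refine Finset.sum_congr rfl fun ν _ => ?_
        calc ∑ x : S, ∑ c : TrIdx N, ∑ c' : TrIdx N, f (x, ν, c, c') * trReForm (trBasis N c) (T (assembleK (trBasis N) ν c' f) x)
            = ∑ x : S, ∑ c' : TrIdx N, ∑ c : TrIdx N, f (x, ν, c, c') * trReForm (trBasis N c) (T (assembleK (trBasis N) ν c' f) x) :=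
              Finset.sum_congr rfl fun x _ => Finset.sum_comm
          _ = _ := Finset.sum_comm
    _ = ∑ ν : D, ∑ c' : TrIdx N, ∑ x : S, trReForm (assembleK (trBasis N) ν c' f x) (T (assembleK (trBasis N) ν c' f) x) := by
        refine Finset.sum_congr rfl fun ν _ => Finset.sum_congr rfl fun c' _ => Finset.sum_congr rfl fun x _ => ?_
        exact assembleK_pairing (trBasis N) trReForm f x ν c' _
    _ = _ := by
        refine Finset.sum_congr rfl fun ν _ => Finset.sum_congr rfl fun c' _ => ?_
        exact sum_trReForm_eq_trIP _ _

variable {d ℓ : ℕ} {hd : 1 ≤ d + 1} {hL : Odd (ℓ + 1) ∧ 1 < ℓ + 1} {b₀ b₁ : ℝ}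

/-- the trace pairing of `0` with anything vanishes. [folklore] -/
private theorem trIP_zero_left {S : Type} [Fintype S] (w : S → ℝ) (Ψ : S → Matrix (Fin N) (Fin N) ℂ) : trIP w 0 Ψ = 0 := by
  simp [trIP]

/-- ★ **`FormSmall.posS0` AT THE PINS FROM ROW 17's POSITIVITY OF Δ_a(U)**: Theorem 3.11's `PosDefTr 1 (deltaAY …(cfg U₁))` (the certificate's displayed
row 17 `hΔA`, weighted trace pairing) gives the REAL-COORDINATE positivity `PosDefEnd` of node00-def-Y's model `S0coK … U₁ = c⁻¹·coordOpK (Δ_a)` — the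
`posS0` member of rows 20–21's `FormSmall` (p. 420 «Δ_a», Theorem 3.11 p. 416), slice by slice (`dotProduct_coordOpK_const_eq_sum_trIP`; a non-zero
coordinate vector has a non-zero slice, `repr_assembleK`). [cite: Balaban1985BackgroundPropagators, Thm 3.11 p.416 + (3.26) p.395 + (3.120) p.419] -/
theorem posDefEnd_S0coK_of_posDefTr (i : KIdx d ℓ hd hL b₀ b₁) (B : B9.Backgrounds) (cfg : B.Cfg → CfgY (Matrix (Fin N) (Fin N) ℂ) i)
    (U₁ : B.Cfg) (hN : 0 < N)
    (hΔ : PosDefTr (fun _ => (1 : ℝ)) (deltaAY i (parSymY i) (parBY i) (GpY i (parSymY i)) (cfg U₁))) :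
    PosDefEnd (S0coK i (trBasis N) B cfg (parSymY i) (parBY i) (GpY i (parSymY i)) U₁) := by
  classical
  intro f hf
  have hc : 0 < cR39 (trBasis N) := cR39_trBasis_pos hN
  -- a non-zero coordinate vector has a non-zero slice
  obtain ⟨p, hp⟩ : ∃ p, f p ≠ 0 := by
    by_contra h
    exact hf (funext fun q => not_not.mp (not_exists.mp h q))
  have hA : assembleK (trBasis N) p.2.1 p.2.2.2 f ≠ 0 := by
    intro h0
    have h1 := repr_assembleK (trBasis N) f p.1 p.2.1 p.2.2.1 p.2.2.2
    rw [h0] at h1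
    simp only [Pi.zero_apply, map_zero, Finsupp.coe_zero] at h1
    exact hp h1.symm
  -- the form is c⁻¹·Σ_{ν,c′} trIP 1 A_{ν,c′} (Δ_a A_{ν,c′})
  have hform : f ⬝ᵥ S0coK i (trBasis N) B cfg (parSymY i) (parBY i) (GpY i (parSymY i)) U₁ f =
      (cR39 (trBasis N))⁻¹ * ∑ ν : Fin (d + 1), ∑ c' : TrIdx N, trIP (fun _ => (1 : ℝ)) (assembleK (trBasis N) ν c' f)
        ((deltaAY i (parSymY i) (parBY i) (GpY i (parSymY i)) (cfg U₁)).restrictScalars ℝ (assembleK (trBasis N) ν c' f)) := by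
    rw [← dotProduct_coordOpK_const_eq_sum_trIP]
    simp only [S0coK, LinearMap.smul_apply, dotProduct_smul, smul_eq_mul]
  rw [hform]
  refine mul_pos (inv_pos.mpr hc) ?_
  have hnn : ∀ (ν : Fin (d + 1)) (c' : TrIdx N), 0 ≤ trIP (fun _ => (1 : ℝ)) (assembleK (trBasis N) ν c' f)
      ((deltaAY i (parSymY i) (parBY i) (GpY i (parSymY i)) (cfg U₁)).restrictScalars ℝ (assembleK (trBasis N) ν c' f)) := fun ν c' => by
    by_cases h0 : assembleK (trBasis N) ν c' f = 0
    · rw [h0, map_zero, trIP_zero_left]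
    · exact (hΔ _ h0).le
  have hpos : 0 < trIP (fun _ => (1 : ℝ)) (assembleK (trBasis N) p.2.1 p.2.2.2 f)
      ((deltaAY i (parSymY i) (parBY i) (GpY i (parSymY i)) (cfg U₁)).restrictScalars ℝ (assembleK (trBasis N) p.2.1 p.2.2.2 f)) := hΔ _ hA
  calc (0 : ℝ) < _ := hpos
    _ ≤ ∑ c' : TrIdx N, trIP (fun _ => (1 : ℝ)) (assembleK (trBasis N) p.2.1 c' f)
          ((deltaAY i (parSymY i) (parBY i) (GpY i (parSymY i)) (cfg U₁)).restrictScalars ℝ (assembleK (trBasis N) p.2.1 c' f)) :=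
        Finset.single_le_sum (fun c' _ => hnn p.2.1 c') (Finset.mem_univ p.2.2.2)
    _ ≤ _ := Finset.single_le_sum (fun ν _ => Finset.sum_nonneg fun c' _ => hnn ν c') (Finset.mem_univ p.2.1)

end PosS0


/-! ## §4 Back to trace currency: a positive real-coordinate model of a constant family gives a positive trace form (one-slice encoding) -/

section TraceCurrency

variable {N : ℕ}

/-- **THE MODEL OF A CONSTANT FAMILY IS POSITIVE (real coordinates) ONLY IF THE OPERATOR IS POSITIVE (trace pairing)**: encode a field `Φ ≠ 0` into
ONE slice `(ν₀, c₀′)` of the coordinate carrier by its trace-basis coordinates; that slice re-assembles to `Φ`, every other slice to `0`, so the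
coordinate form is `trIP 1 Φ (T Φ)` (`dotProduct_coordOpK_const_eq_sum_trIP`). [cite: Balaban1985BackgroundPropagators, p.393 (scalar products) + (3.42) p.397, dictionary] -/
theorem posDefTr_of_posDefEnd_coordOpK_const {S D : Type} [Fintype S] [Fintype D] [DecidableEq D] [Nonempty D] (hN : 0 < N)
    (T : (S → Matrix (Fin N) (Fin N) ℂ) →ₗ[ℂ] (S → Matrix (Fin N) (Fin N) ℂ))
    (h : PosDefEnd (coordOpK (trBasis N) (fun _ : D => T.restrictScalars ℝ))) : PosDefTr (fun _ => (1 : ℝ)) T := by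
  classical
  haveI : Nonempty (TrIdx N) := nonempty_trIdx hN
  obtain ⟨ν₀⟩ := ‹Nonempty D›
  obtain ⟨c₀⟩ := ‹Nonempty (TrIdx N)›
  intro Φ hΦ
  -- the one-slice encoding of Φ
  set f : S × D × TrIdx N × TrIdx N → ℝ := fun p => if p.2.1 = ν₀ ∧ p.2.2.2 = c₀ then (trBasis N).repr (Φ p.1) p.2.2.1 else 0 with hf
  have hslice : ∀ (ν : D) (c' : TrIdx N), assembleK (trBasis N) ν c' f = if ν = ν₀ ∧ c' = c₀ then Φ else 0 := fun ν c' => by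
    funext z
    by_cases hνc : ν = ν₀ ∧ c' = c₀
    · simp only [assembleK, hf, hνc, and_self, if_true]
      exact (trBasis N).sum_repr (Φ z)
    · simp only [assembleK, hf, hνc, if_false, zero_smul, Finset.sum_const_zero, Pi.zero_apply]
  have hf0 : f ≠ 0 := by
    intro h0
    apply hΦ
    funext z
    have hz : ∀ a : TrIdx N, (trBasis N).repr (Φ z) a = 0 := fun a => by
      have h' := congrFun h0 (z, ν₀, a, c₀)
      simpa only [hf, and_self, if_true, Pi.zero_apply] using h'
    have hr : (trBasis N).repr (Φ z) = 0 := Finsupp.ext hz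
    simpa using hr
  have hpos := h f hf0
  rw [dotProduct_coordOpK_const_eq_sum_trIP] at hpos
  -- only the slice (ν₀, c₀) survives
  have hsum : ∑ ν : D, ∑ c' : TrIdx N, trIP (fun _ => (1 : ℝ)) (assembleK (trBasis N) ν c' f)
      ((T.restrictScalars ℝ) (assembleK (trBasis N) ν c' f)) = trIP (fun _ => (1 : ℝ)) Φ (T Φ) := by
    rw [Finset.sum_eq_single ν₀, Finset.sum_eq_single c₀]
    · rw [hslice]; simp only [and_self, if_true, LinearMap.coe_restrictScalars]
    · intro c' _ hc'
      rw [hslice, if_neg (fun h => hc' h.2), map_zero, trIP_zero_left]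
    · intro h; exact absurd (Finset.mem_univ c₀) h
    · intro ν _ hν
      refine Finset.sum_eq_zero fun c' _ => ?_
      rw [hslice, if_neg (fun h => hν h.1), map_zero, trIP_zero_left]
    · intro h; exact absurd (Finset.mem_univ ν₀) h
  rw [hsum] at hpos
  exact hpos

variable {d ℓ : ℕ} {hd : 1 ≤ d + 1} {hL : Odd (ℓ + 1) ∧ 1 < ℓ + 1} {b₀ b₁ : ℝ}

/-- ★ **Δ⁽¹⁾(U) = Δ_a − Δ′_π − Δ⁽²⁾_π IS POSITIVE IN TRACE CURRENCY FROM THE FORM SMALLNESS AT THE PINS** — the input `hΔ1 : PosDefTr 1 (deltaOneY …)` of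
node00-def-Y g12's `isUnit_QGQOfY_G1Y_record_of_posDefTr` (which discharges the certificate's last displayed unit `hUQ`, [4] (2.35) «QGQ* is positive also»):
rows 20–21's `FormSmall 𝔬 r U` with `r < 1` gives `S0 − (Tpi + T2) > 0` in real coordinates, the pins make it `c⁻¹·coordOpK (Δ⁽¹⁾)`, and §4's one-slice
encoding returns to the trace pairing.  (The PINS-keyed route; node00-def-Y g12's `Node00.OpsYQOnto.posDefTr_deltaOneY_of_form_small` is the trace-currency
sibling from `PosDefTr 1 (deltaPiAY …)` + a relative trace-form bound on Δ⁽²⁾_π — different hypotheses, one declarer each per dag-lead DEDUP-331 (2).) [cite: Balaban1985BackgroundPropagators, (3.128) p.421 + (3.134)–(3.138) pp.422–423 + Thm 3.11 p.416; Balaban1984PropagatorsII, (2.35) p.229] -/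
theorem posDefTr_deltaOneY_of_formSmall_pins (i : KIdx d ℓ hd hL b₀ b₁) (B : B9.Backgrounds) (cfg : B.Cfg → CfgY (Matrix (Fin N) (Fin N) ℂ) i)
    (Δ2 : BondOpY (Matrix (Fin N) (Fin N) ℂ) i) {g : B9.Geometry} {Y Z W : Type} [Fintype Y] [Fintype Z] [Fintype W]
    (𝔬 : Ops g B (XBK (TrIdx N) i) Y Z W) (U : B.Cfg) {r : ℝ} (hN : 0 < N) (hF : FormSmall 𝔬 r U) (hr : r < 1)
    (hS0 : 𝔬.S0 U = S0coK i (trBasis N) B cfg (parSymY i) (parBY i) (GpY i (parSymY i)) U)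
    (hTpi : 𝔬.Tpi U = TpicoK i (trBasis N) B cfg (parSymY i) (GpY i (parSymY i)) U)
    (hT2 : 𝔬.T2 U = T2coK i (trBasis N) B cfg (parSymY i) (GpY i (parSymY i)) Δ2 U) :
    PosDefTr (fun _ => (1 : ℝ)) (deltaOneY i (parSymY i) (parBY i) (GpY i (parSymY i)) Δ2 (cfg U)) := by
  have hc : 0 < cR39 (trBasis N) := cR39_trBasis_pos hN
  -- S0 − (Tpi + T2) is positive in real coordinates: ⟨f, (S − T)f⟩ ≥ (1 − r)⟨f, Sf⟩ > 0
  have hposR : PosDefEnd (𝔬.S0 U - (𝔬.Tpi U + 𝔬.T2 U)) := fun f hf => by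
    have h0 : 0 < f ⬝ᵥ 𝔬.S0 U f := hF.posS0 f hf
    have h1 : f ⬝ᵥ (𝔬.Tpi U + 𝔬.T2 U) f ≤ r * (f ⬝ᵥ 𝔬.S0 U f) := (abs_le.mp (hF.small1 f)).2
    have h2 : r * (f ⬝ᵥ 𝔬.S0 U f) < f ⬝ᵥ 𝔬.S0 U f := mul_lt_of_lt_one_left h0 hr
    rw [LinearMap.sub_apply, dotProduct_sub]
    linarith
  have hEq : 𝔬.S0 U - (𝔬.Tpi U + 𝔬.T2 U) = (cR39 (trBasis N))⁻¹ •
      coordOpK (trBasis N) (fun _ : Fin (d + 1) => (deltaOneY i (parSymY i) (parBY i) (GpY i (parSymY i)) Δ2 (cfg U)).restrictScalars ℝ) := by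
    have hfam : (fun _ : Fin (d + 1) => (deltaOneY i (parSymY i) (parBY i) (GpY i (parSymY i)) Δ2 (cfg U)).restrictScalars ℝ) =
        fun _ : Fin (d + 1) => (deltaAY i (parSymY i) (parBY i) (GpY i (parSymY i)) (cfg U)).restrictScalars ℝ -
          ((deltaPiPrimeY i (parSymY i) (GpY i (parSymY i)) (cfg U)).restrictScalars ℝ +
            (delta2PiY i (parSymY i) (GpY i (parSymY i)) Δ2 (cfg U)).restrictScalars ℝ) := by
      funext ν
      apply LinearMap.ext
      intro v
      simp only [LinearMap.coe_restrictScalars, LinearMap.sub_apply, LinearMap.add_apply, deltaOneY_eq_deltaAY_sub]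
    rw [hS0, hTpi, hT2, hfam, coordOpK_sub, coordOpK_add, smul_sub, smul_add]
    rfl
  rw [hEq] at hposR
  -- positivity survives the positive scalar c⁻¹
  have hposR' : PosDefEnd (coordOpK (trBasis N)
      (fun _ : Fin (d + 1) => (deltaOneY i (parSymY i) (parBY i) (GpY i (parSymY i)) Δ2 (cfg U)).restrictScalars ℝ)) := fun f hf => by
    have h := hposR f hf
    rw [LinearMap.smul_apply, dotProduct_smul, smul_eq_mul] at h
    exact (mul_pos_iff_of_pos_left (inv_pos.mpr hc)).mp h
  exact posDefTr_of_posDefEnd_coordOpK_const hN _ hposR'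

end TraceCurrency

end Summit.QuantumFields.YangMills.BalabanUVNodes.N06SectDUnitsAtPins

end
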